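/-
Copyright (c) 2026 the pub-hodgecm-mathlib formalisation cell (harness21).  Prover seat hodgecm-mathlib-K2E5-p12 (g0), Track B ∕ K2-LIT, h413 = `stmt-HodgeConjecture-24833`,
line `K2_E3_EllipticInputs`, unit U3b, sub-line «U3b-c RANK-ONE GERMS», letter (ii♭-H): FILE 1 of the RANK-ONE (`N = 2`) twin of the ‹Ψ-package› — the eigenvalue ball of
`U(σ, J)(K) ≤ GL₂(K)` and the Cayley scaling on it (DEAL K2E3-plan (g1), K2/STATUS.md 2026-09-03T23:27:26Z (b); consult K2E3-p01 (g0) 23:28:10Z).  2026-09-03.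
-/
import Summits.HodgeConjecture.HodgeConjecture.Theorems.K2E3CayleyScalingModel   -- ★ K2E3-p01 (p855443): `continuousAt_matrix_inv` (any `n`); brings ★ Algebra (p855377: `inverseWindow_cayley`, `inverseWindow_conj`, `det_conj_add_one`, `norm_one_add_eq_one`), ★ p855173, ★ `cayleyGL`, (Q3)
import Mathlib.Topology.MetricSpace.Ultra.Basic                                    -- `IsUltrametricDist.isOpen_closedBall`
import HarnessLib

/-!
# h413 ∕ Track B «K2-LIT», line `K2_E3_EllipticInputs`, unit U3b, (ii♭-H): THE RANK-ONE CAYLEY SCALING, FILE 1 — the eigenvalue ball of `U(σ, J)(K) ≤ GL₂(K)` is a clopen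
# Ad-stable neighbourhood of `1` on which `Ψ_s = c ∘ (s·) ∘ c⁻¹` is defined (`N = 2` twin of ★ `K2E3CayleyScalingModel`)

Cell `pub/hodgecm-mathlib`, crux H413 = `stmt-HodgeConjecture-24833`, route of record `HCCMUnconditional`; chair K2-lead (g0), dealer K2E3-plan (g1), line lead (ii) K2E4-p06 (g2),
consult K2E3-p01 (g0).  THEOREMS ONLY (no `def`, no `instance`, no `notation`, no named-fact hypothesis, no `sorry`); imports = ★ + Mathlib + HarnessLib; lane
`--supports stmt-HodgeConjecture-24833 --as helper` (count-neutral).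

DESIGN (no definitions; the PAIR version of ★ K2E3-p01's coefficient-TRIPLE design).  `K` is an ultrametric normed field, `σ : K →+* K`, `J ∈ M₂(K)`, `M = U(σ, J)(K)`
(★ `unitaryGroupOfForm σ J ≤ GL₂(K)`); for `u ∈ M` with matrix `g` put `X_u = c⁻¹(g) = (g − 1)(g + 1)⁻¹`.  The EIGENVALUE BALL `B` of radius `ρ` is a VARIABLE CHARACTERISED BY A
HYPOTHESIS (so that the rank-one scaling law and U3b's (ii♭-H) assembly quantify over every pair `(Ψ, B)` and no `def` is shared between files):
`hB : ∀ u, u ∈ B ↔ det(g + 1) ∈ Kˣ ∧ ‖tr X_u‖ ≤ ρ ∧ ‖det X_u‖ ≤ ρ²` (both eigenvalues of `X_u` of absolute value `≤ ρ`: `χ_{X_u} = T² − tr X_u·T + det X_u`, Mathlib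
`Matrix.charpoly_fin_two`; every unipotent `u` lies in `B`, `X_u` being nilpotent).

RESULTS ([PlatonovRapinchuk1994] §3.3; [HarishChandra1999] §3.1 Lemma 3.2).  §1 the `2 × 2` scalar algebra: `det(1 ∓ X) = 1 ∓ tr X + det X`, `tr(t•X) = t·tr X`,
`det(t•X) = t²·det X`, hence `‖det(1 ∓ X)‖ = 1` on the ball and scaling by `‖t‖ ≤ 1` preserves the ball; §2 continuity of `g ↦ X_g` and of `g ↦ c(s•X_g)` (any size `n`),
skewness of `t•X` for `σ t = t` (any `n`); §3 for `0 < ρ < 1`, `2 ≠ 0`: `isUnit_of_mem_ball`, `norm_det_add_one_of_mem_ball` (`‖det(g + 1)‖ = ‖4‖` on `B`),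
`ball_isClopen` + `one_mem_ball_nhds` (U1: a clopen neighbourhood of `1`), `conj_mem_ball_iff` (U2: Ad-stable), and `exists_cayleyScaling`: a map `Ψ : M → M` with `mat(Ψ u) = c(s•X_u)`,
`mat((Ψ u)⁻¹) = c(−s•X_u)` on `B` (`σ s = s`, `‖s‖ρ < 1`).  FILE 2 (`K2E3CayleyScalingRankOneMap`) proves (E)(Z)(R)(C)(T)(S) for any such `Ψ`.

HONEST LABEL.  HC_CM is proved only modulo the 7 printed citations (2 remaining named inputs: hLiu418 = `stmt-HodgeConjecture-24832`, h413 =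
`stmt-HodgeConjecture-24833`) until rung 0 closes; this file is a count-neutral helper of the U3b-c sub-line.

## References
* [PlatonovRapinchuk1994] V. Platonov, A. Rapinchuk, *Algebraic Groups and Number Theory* (1994), §3.3 (Cayley parametrisation; congruence neighbourhoods).
* [HarishChandra1999AdmissibleDistributions] Harish-Chandra, *Admissible Invariant Distributions on Reductive p-adic Groups*, ULS 16 (1999), §3.1 Lemma 3.2.
* [Rogawski1990] J. Rogawski, *Automorphic representations of unitary groups in three variables*, Ann. of Math. Stud. 123 (1990), §8.1 Prop. 8.1.2 (b) p. 114.
-/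

set_option autoImplicit false
-- the mandated namespace repeats the single-problem summit's segment (`HodgeConjecture.HodgeConjecture`), as in every `Theorems/*.lean` of this sub-problem
set_option linter.dupNamespace false

noncomputable section

open Filter Topology Polynomial Set
open scoped Matrix MatrixGroups
open Literature.NumberTheory.Automorphic Literature.NumberTheory.Weil1982.UnitaryFinTopForm Literature.LinearAlgebra.Matrix
open Summit.HodgeConjecture.HodgeConjecture.Cruxes.H413.K2E3CompactCartanRegularRay
open Summit.HodgeConjecture.HodgeConjecture.Cruxes.H413.K2E3CayleyScalingAlgebra
open Summit.HodgeConjecture.HodgeConjecture.Cruxes.H413.K2E3CayleyScalingModel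

namespace Summit.HodgeConjecture.HodgeConjecture.Cruxes.H413.K2E3CayleyScalingRankOne

/-! ## §1 The `2 × 2` scalar algebra: `det(1 ∓ X)`, scaling of `(tr, det)`, the eigenvalue ball over an ultrametric field -/

section Ring

variable {R : Type*} [CommRing R]

/-- `det(1 − X) = 1 − tr X + det X` and `det(1 + X) = 1 + tr X + det X` for a `2 × 2` matrix (`χ_X(±1)`). [cite: PlatonovRapinchuk1994, §3.3] -/
theorem det_one_sub_add_eq_fin_two (X : Matrix (Fin 2) (Fin 2) R) : (1 - X).det = 1 - X.trace + X.det ∧ (1 + X).det = 1 + X.trace + X.det := by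
  rw [Matrix.det_fin_two, Matrix.det_fin_two, Matrix.det_fin_two, Matrix.trace_fin_two]
  simp only [Matrix.sub_apply, Matrix.add_apply, Matrix.one_apply_eq, Matrix.one_apply_ne (by decide : (0 : Fin 2) ≠ 1),
    Matrix.one_apply_ne (by decide : (1 : Fin 2) ≠ 0)]
  constructor <;> ring

/-- `tr(t•X) = t·tr X` and `det(t•X) = t²·det X` for a `2 × 2` matrix. [cite: HarishChandra1999AdmissibleDistributions, §3.1 Lemma 3.2] -/
theorem trace_smul_det_smul_fin_two (t : R) (X : Matrix (Fin 2) (Fin 2) R) : (t • X).trace = t * X.trace ∧ (t • X).det = t ^ 2 * X.det := by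
  refine ⟨by rw [Matrix.trace_smul, smul_eq_mul], ?_⟩
  rw [Matrix.det_smul, Fintype.card_fin]

/-- Scaling a skew matrix by a `σ`-fixed scalar keeps it skew (any size): `ᵗσ(t•X)·J + J·(t•X) = t•(ᵗσX·J + J·X) = 0`. [cite: PlatonovRapinchuk1994, §3.3] -/
theorem skew_smul_of_fixed' {n : Type*} [Fintype n] [DecidableEq n] (σ : R →+* R) {J X₀ : Matrix n n R} (hX₀ : (X₀.map σ)ᵀ * J + J * X₀ = 0) {t : R} (ht : σ t = t) :
    ((t • X₀).map σ)ᵀ * J + J * (t • X₀) = 0 := by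
  have hmap : (t • X₀).map σ = t • X₀.map σ := by
    ext i j
    simp only [Matrix.map_apply, Matrix.smul_apply, smul_eq_mul, map_mul, ht]
  rw [hmap, Matrix.transpose_smul, Matrix.smul_mul, Matrix.mul_smul, ← smul_add, hX₀, smul_zero]

end Ring

section Ultrametric

variable {K : Type*} [NormedField K] [IsUltrametricDist K]

/-- The sum of the two «small» invariants is small: `‖a‖ ≤ ρ`, `‖b‖ ≤ ρ²`, `ρ < 1` ⇒ `‖−a + b‖ ≤ ρ` and `‖a + b‖ ≤ ρ`. [folklore] -/
theorem norm_pair_sum_le {a b : K} {ρ : ℝ} (hρ : ρ < 1) (ha : ‖a‖ ≤ ρ) (hb : ‖b‖ ≤ ρ ^ 2) : ‖-a + b‖ ≤ ρ ∧ ‖a + b‖ ≤ ρ := by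
  have hρ0 : 0 ≤ ρ := (norm_nonneg _).trans ha
  have hρ2 : ρ ^ 2 ≤ ρ := by nlinarith
  have hb' : ‖b‖ ≤ ρ := hb.trans hρ2
  exact ⟨(IsUltrametricDist.norm_add_le_max _ _).trans (max_le (by rw [norm_neg]; exact ha) hb'),
    (IsUltrametricDist.norm_add_le_max _ _).trans (max_le ha hb')⟩

/-- **`‖det(1 − X)‖ = 1` on the eigenvalue ball** (`det(1 − X) = 1 + (−tr X + det X)`). [cite: PlatonovRapinchuk1994, §3.3] -/
theorem norm_det_one_sub_eq_one {X : Matrix (Fin 2) (Fin 2) K} {ρ : ℝ} (hρ : ρ < 1) (ht : ‖X.trace‖ ≤ ρ) (hd : ‖X.det‖ ≤ ρ ^ 2) : ‖(1 - X).det‖ = 1 := by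
  rw [(det_one_sub_add_eq_fin_two X).1, sub_eq_add_neg, add_assoc]
  exact norm_one_add_eq_one ((norm_pair_sum_le hρ ht hd).1.trans_lt hρ)

/-- **`‖det(1 + X)‖ = 1` on the eigenvalue ball** (`det(1 + X) = 1 + (tr X + det X)`). [cite: PlatonovRapinchuk1994, §3.3] -/
theorem norm_det_one_add_eq_one {X : Matrix (Fin 2) (Fin 2) K} {ρ : ℝ} (hρ : ρ < 1) (ht : ‖X.trace‖ ≤ ρ) (hd : ‖X.det‖ ≤ ρ ^ 2) : ‖(1 + X).det‖ = 1 := by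
  rw [(det_one_sub_add_eq_fin_two X).2, add_assoc]
  exact norm_one_add_eq_one ((norm_pair_sum_le hρ ht hd).2.trans_lt hρ)

/-- On the eigenvalue ball `det(1 − X)` and `det(1 + X)` are units (absolute value `1`). [cite: PlatonovRapinchuk1994, §3.3] -/
theorem isUnit_det_one_sub_add_of_ball {X : Matrix (Fin 2) (Fin 2) K} {ρ : ℝ} (hρ : ρ < 1) (ht : ‖X.trace‖ ≤ ρ) (hd : ‖X.det‖ ≤ ρ ^ 2) :
    IsUnit (1 - X).det ∧ IsUnit (1 + X).det := by
  constructor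
  · exact isUnit_iff_ne_zero.2 fun h => by have := norm_det_one_sub_eq_one hρ ht hd; rw [h, norm_zero] at this; exact zero_ne_one this
  · exact isUnit_iff_ne_zero.2 fun h => by have := norm_det_one_add_eq_one hρ ht hd; rw [h, norm_zero] at this; exact zero_ne_one this

omit [IsUltrametricDist K] in
/-- **Scaling contracts the eigenvalue ball**: `(tr, det)(t•X)` obey the bounds with `‖t‖·ρ` in place of `ρ`. [cite: HarishChandra1999AdmissibleDistributions, §3.1 Lemma 3.2] -/
theorem ball_smul (t : K) {X : Matrix (Fin 2) (Fin 2) K} {ρ : ℝ} (ht : ‖X.trace‖ ≤ ρ) (hd : ‖X.det‖ ≤ ρ ^ 2) :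
    ‖(t • X).trace‖ ≤ ‖t‖ * ρ ∧ ‖(t • X).det‖ ≤ (‖t‖ * ρ) ^ 2 := by
  obtain ⟨e1, e2⟩ := trace_smul_det_smul_fin_two t X
  rw [e1, e2, norm_mul, norm_mul, norm_pow, mul_pow]
  exact ⟨mul_le_mul_of_nonneg_left ht (norm_nonneg _), mul_le_mul_of_nonneg_left hd (pow_nonneg (norm_nonneg _) _)⟩

omit [IsUltrametricDist K] in
/-- The contracted ball lies in the original one when `‖t‖ ≤ 1`. [cite: HarishChandra1999AdmissibleDistributions, §3.1 Lemma 3.2] -/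
theorem ball_smul_of_norm_le_one {t : K} (ht1 : ‖t‖ ≤ 1) {X : Matrix (Fin 2) (Fin 2) K} {ρ : ℝ} (ht : ‖X.trace‖ ≤ ρ) (hd : ‖X.det‖ ≤ ρ ^ 2) :
    ‖(t • X).trace‖ ≤ ρ ∧ ‖(t • X).det‖ ≤ ρ ^ 2 := by
  have hρ0 : 0 ≤ ρ := (norm_nonneg _).trans ht
  have htρ : ‖t‖ * ρ ≤ ρ := by nlinarith [norm_nonneg t]
  have htρ0 : 0 ≤ ‖t‖ * ρ := mul_nonneg (norm_nonneg _) hρ0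
  obtain ⟨e1, e2⟩ := ball_smul t ht hd
  exact ⟨e1.trans htρ, e2.trans (pow_le_pow_left₀ htρ0 htρ 2)⟩

end Ultrametric

/-! ## §2 Continuity of `g ↦ X_g` and of the scaled Cayley chart (any size `n`) -/

section Continuity

variable {K : Type*} [NormedField K] {n : Type*} [Fintype n] [DecidableEq n]

/-- The inverse Cayley transform `g ↦ (g − 1)(g + 1)⁻¹` is continuous at every `g` with `g + 1` invertible (any size). [cite: PlatonovRapinchuk1994, §3.3] -/
theorem continuousAt_inverseWindow {g₀ : Matrix n n K} (h : (g₀ + 1).det ≠ 0) :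
    ContinuousAt (fun g : Matrix n n K => (g - 1) * (g + 1)⁻¹) g₀ := by
  have h1 : Tendsto (fun g : Matrix n n K => g - 1) (𝓝 g₀) (𝓝 (g₀ - 1)) := tendsto_id.sub tendsto_const_nhds
  have h2 : Tendsto (fun g : Matrix n n K => g + 1) (𝓝 g₀) (𝓝 (g₀ + 1)) := tendsto_id.add tendsto_const_nhds
  have h3 : Tendsto (fun g : Matrix n n K => (g + 1)⁻¹) (𝓝 g₀) (𝓝 (g₀ + 1)⁻¹) := (continuousAt_matrix_inv h).tendsto.comp h2
  exact h1.mul h3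

/-- The scaled Cayley transform `g ↦ c(s•(g − 1)(g + 1)⁻¹)` is continuous at every `g` with `g + 1` and `1 − s•X_g` invertible (any size). [cite: PlatonovRapinchuk1994, §3.3] -/
theorem continuousAt_cayley_smul_inverseWindow (s : K) {g₀ : Matrix n n K} (h : (g₀ + 1).det ≠ 0)
    (hm : (1 - s • ((g₀ - 1) * (g₀ + 1)⁻¹)).det ≠ 0) :
    ContinuousAt (fun g : Matrix n n K => cayley (s • ((g - 1) * (g + 1)⁻¹))) g₀ := by
  have hX : Tendsto (fun g : Matrix n n K => s • ((g - 1) * (g + 1)⁻¹)) (𝓝 g₀) (𝓝 (s • ((g₀ - 1) * (g₀ + 1)⁻¹))) :=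
    (continuousAt_inverseWindow h).tendsto.const_smul s
  have hp : Tendsto (fun g : Matrix n n K => 1 + s • ((g - 1) * (g + 1)⁻¹)) (𝓝 g₀) (𝓝 (1 + s • ((g₀ - 1) * (g₀ + 1)⁻¹))) :=
    tendsto_const_nhds.add hX
  have hm' : Tendsto (fun g : Matrix n n K => 1 - s • ((g - 1) * (g + 1)⁻¹)) (𝓝 g₀) (𝓝 (1 - s • ((g₀ - 1) * (g₀ + 1)⁻¹))) :=
    tendsto_const_nhds.sub hX
  have hmi : Tendsto (fun g : Matrix n n K => (1 - s • ((g - 1) * (g + 1)⁻¹))⁻¹) (𝓝 g₀) (𝓝 (1 - s • ((g₀ - 1) * (g₀ + 1)⁻¹))⁻¹) :=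
    (continuousAt_matrix_inv hm).tendsto.comp hm'
  show Tendsto _ _ _
  simp only [cayley_def]
  exact hp.mul hmi

/-- The matrix of an element of `U(σ, J)(K)` depends continuously on it (any size). [folklore] -/
theorem continuous_coe_mat (σ : K →+* K) (J : Matrix n n K) : Continuous fun u : ↥(unitaryGroupOfForm σ J) => ((u : GL n K) : Matrix n n K) :=
  Units.continuous_val.comp continuous_subtype_val

end Continuity

/-! ## §3 The eigenvalue ball of `U(σ, J)(K) ≤ GL₂(K)`: side conditions, `1 ∈ B`, open, closed, Ad-stable; the Cayley scaling exists -/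

section Model

variable {K : Type*} [NormedField K] [IsUltrametricDist K] (σ : K →+* K) (J : Matrix (Fin 2) (Fin 2) K) {ρ : ℝ} {s : K}
  {B : Set ↥(unitaryGroupOfForm σ J)}
  (hB : ∀ u : ↥(unitaryGroupOfForm σ J), u ∈ B ↔
    IsUnit (((u : GL (Fin 2) K) : Matrix (Fin 2) (Fin 2) K) + 1).det ∧
    ‖((((u : GL (Fin 2) K) : Matrix (Fin 2) (Fin 2) K) - 1) * (((u : GL (Fin 2) K) : Matrix (Fin 2) (Fin 2) K) + 1)⁻¹).trace‖ ≤ ρ ∧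
    ‖((((u : GL (Fin 2) K) : Matrix (Fin 2) (Fin 2) K) - 1) * (((u : GL (Fin 2) K) : Matrix (Fin 2) (Fin 2) K) + 1)⁻¹).det‖ ≤ ρ ^ 2)

include hB in
/-- **The side conditions on the ball**: for `u ∈ B` and `‖s‖·ρ < 1`, `det(g + 1)`, `det(1 − s•X_u)` and `det(1 + s•X_u)` are units (the scaled `s•X_u` lies in the `‖s‖ρ`-ball).
[cite: PlatonovRapinchuk1994, §3.3] -/
theorem isUnit_of_mem_ball (hsρ : ‖s‖ * ρ < 1) {u : ↥(unitaryGroupOfForm σ J)} (hu : u ∈ B) :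
    IsUnit (((u : GL (Fin 2) K) : Matrix (Fin 2) (Fin 2) K) + 1).det ∧
    IsUnit (1 - s • ((((u : GL (Fin 2) K) : Matrix (Fin 2) (Fin 2) K) - 1) * (((u : GL (Fin 2) K) : Matrix (Fin 2) (Fin 2) K) + 1)⁻¹)).det ∧
    IsUnit (1 + s • ((((u : GL (Fin 2) K) : Matrix (Fin 2) (Fin 2) K) - 1) * (((u : GL (Fin 2) K) : Matrix (Fin 2) (Fin 2) K) + 1)⁻¹)).det := by
  obtain ⟨hP, ht, hd⟩ := (hB u).1 hu
  obtain ⟨et, ed⟩ := ball_smul s ht hd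
  exact ⟨hP, isUnit_det_one_sub_add_of_ball hsρ et ed⟩

include hB in
omit [IsUltrametricDist K] in
/-- `1 ∈ B` (`0 ≤ ρ`, `2 ≠ 0`): `X_1 = 0` has trace and determinant `0`, and `det(1 + 1) = 4`. [cite: PlatonovRapinchuk1994, §3.3] -/
private theorem one_mem_ball_aux (hρ : 0 ≤ ρ) (h2 : (2 : K) ≠ 0) : (1 : ↥(unitaryGroupOfForm σ J)) ∈ B := by
  rw [hB]
  have h1 : (((1 : ↥(unitaryGroupOfForm σ J)) : GL (Fin 2) K) : Matrix (Fin 2) (Fin 2) K) = 1 := rfl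
  rw [h1, sub_self, Matrix.zero_mul, Matrix.trace_zero, Matrix.det_zero, norm_zero]
  have h4 : ((1 : Matrix (Fin 2) (Fin 2) K) + 1).det = 2 ^ 2 := by
    rw [show (1 : Matrix (Fin 2) (Fin 2) K) + 1 = (2 : K) • (1 : Matrix (Fin 2) (Fin 2) K) by rw [two_smul], Matrix.det_smul, Matrix.det_one, mul_one,
      Fintype.card_fin]
  refine ⟨?_, hρ, pow_nonneg hρ 2⟩
  rw [h4]; exact (isUnit_iff_ne_zero.2 h2).pow 2

include hB in
/-- **`‖det(g + 1)‖ = ‖4‖` on the ball** (`ρ < 1`): `g = c(X_u)` (★ `cayley_inverseWindow`), so `g + 1 = 2·(1 − X_u)⁻¹` (★ `cayley_add_one`) and `‖det(1 − X_u)‖ = 1`.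
[cite: PlatonovRapinchuk1994, §3.3] -/
theorem norm_det_add_one_of_mem_ball (hρ : ρ < 1) (h2 : (2 : K) ≠ 0) {u : ↥(unitaryGroupOfForm σ J)} (hu : u ∈ B) :
    ‖(((u : GL (Fin 2) K) : Matrix (Fin 2) (Fin 2) K) + 1).det‖ = ‖(4 : K)‖ := by
  obtain ⟨hP, ht, hd⟩ := (hB u).1 hu
  have h2u : IsUnit (2 : K) := isUnit_iff_ne_zero.2 h2
  obtain ⟨hm, hcay⟩ := cayley_inverseWindow h2u hP
  set X₀ := ((((u : GL (Fin 2) K) : Matrix (Fin 2) (Fin 2) K) - 1) * (((u : GL (Fin 2) K) : Matrix (Fin 2) (Fin 2) K) + 1)⁻¹) with hX₀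
  have hg1 : ((u : GL (Fin 2) K) : Matrix (Fin 2) (Fin 2) K) + 1 = (2 : K) • (1 - X₀)⁻¹ := by
    conv_lhs => rw [← hcay]
    exact cayley_add_one hm
  rw [hg1, Matrix.det_smul, Matrix.det_nonsing_inv, Ring.inverse_eq_inv, norm_mul, norm_inv, norm_det_one_sub_eq_one hρ ht hd, inv_one, mul_one,
    norm_pow, Fintype.card_fin, show (4 : K) = 2 ^ 2 by norm_num, norm_pow]

include hB in
/-- `B` is open (`0 < ρ`): `{det(g + 1) ≠ 0}` is open, `X_u` is continuous there, `tr` and `det` are continuous, and closed balls of an ultrametric field are open.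
[cite: PlatonovRapinchuk1994, §3.3] -/
private theorem isOpen_ball_aux (hρ : 0 < ρ) : IsOpen B := by
  rw [isOpen_iff_mem_nhds]
  intro u hu
  obtain ⟨hP, ht, hd⟩ := (hB u).1 hu
  have hP' : (((u : GL (Fin 2) K) : Matrix (Fin 2) (Fin 2) K) + 1).det ≠ 0 := hP.ne_zero
  -- `X`, its trace and determinant, and `det(g + 1)` are continuous at `u`
  have hX : Tendsto (fun u' : ↥(unitaryGroupOfForm σ J) =>
      (((u' : GL (Fin 2) K) : Matrix (Fin 2) (Fin 2) K) - 1) * (((u' : GL (Fin 2) K) : Matrix (Fin 2) (Fin 2) K) + 1)⁻¹) (𝓝 u)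
      (𝓝 ((((u : GL (Fin 2) K) : Matrix (Fin 2) (Fin 2) K) - 1) * (((u : GL (Fin 2) K) : Matrix (Fin 2) (Fin 2) K) + 1)⁻¹)) :=
    (continuousAt_inverseWindow hP').tendsto.comp ((continuous_coe_mat σ J).tendsto u)
  have htr : Tendsto (fun u' : ↥(unitaryGroupOfForm σ J) =>
      ((((u' : GL (Fin 2) K) : Matrix (Fin 2) (Fin 2) K) - 1) * (((u' : GL (Fin 2) K) : Matrix (Fin 2) (Fin 2) K) + 1)⁻¹).trace) (𝓝 u)
      (𝓝 (((((u : GL (Fin 2) K) : Matrix (Fin 2) (Fin 2) K) - 1) * (((u : GL (Fin 2) K) : Matrix (Fin 2) (Fin 2) K) + 1)⁻¹).trace)) :=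
    ((continuous_id.matrix_trace).tendsto _).comp hX
  have hdt : Tendsto (fun u' : ↥(unitaryGroupOfForm σ J) =>
      ((((u' : GL (Fin 2) K) : Matrix (Fin 2) (Fin 2) K) - 1) * (((u' : GL (Fin 2) K) : Matrix (Fin 2) (Fin 2) K) + 1)⁻¹).det) (𝓝 u)
      (𝓝 (((((u : GL (Fin 2) K) : Matrix (Fin 2) (Fin 2) K) - 1) * (((u : GL (Fin 2) K) : Matrix (Fin 2) (Fin 2) K) + 1)⁻¹).det)) :=
    ((continuous_id.matrix_det).tendsto _).comp hX
  have hdetc : Continuous fun u' : ↥(unitaryGroupOfForm σ J) => (((u' : GL (Fin 2) K) : Matrix (Fin 2) (Fin 2) K) + 1).det :=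
    ((continuous_coe_mat σ J).add continuous_const).matrix_det
  -- each of the three conditions holds near `u`
  have e0 : ∀ᶠ u' : ↥(unitaryGroupOfForm σ J) in 𝓝 u, IsUnit (((u' : GL (Fin 2) K) : Matrix (Fin 2) (Fin 2) K) + 1).det :=
    (hdetc.continuousAt.eventually_ne hP').mono fun u' h => isUnit_iff_ne_zero.2 h
  have eball : ∀ {f : ↥(unitaryGroupOfForm σ J) → K} (c : ℝ), 0 < c → ‖f u‖ ≤ c → Tendsto f (𝓝 u) (𝓝 (f u)) →
      ∀ᶠ u' : ↥(unitaryGroupOfForm σ J) in 𝓝 u, ‖f u'‖ ≤ c := by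
    intro f c hc hk hf
    have hmem : ∀ᶠ y in 𝓝 (f u), y ∈ Metric.closedBall (0 : K) c := (IsUltrametricDist.isOpen_closedBall (0 : K) hc.ne').mem_nhds (by simpa using hk)
    exact (hf.eventually hmem).mono fun u' h => by simpa using h
  filter_upwards [e0, eball ρ hρ ht htr, eball (ρ ^ 2) (pow_pos hρ 2) hd hdt] with u' h ht' hd'
  exact (hB u').2 ⟨h, ht', hd'⟩

include hB in
/-- `B` is closed (`ρ < 1`, `2 ≠ 0`): `B` lies in the closed set `A = {‖det(g + 1)‖ = ‖4‖}`, on which `X_u`, `tr X_u`, `det X_u` are continuous, and `B` is cut out of `A` by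
closed conditions (`ContinuousOn.preimage_isClosed_of_isClosed`). [cite: PlatonovRapinchuk1994, §3.3] -/
private theorem isClosed_ball_aux (hρ : ρ < 1) (h2 : (2 : K) ≠ 0) : IsClosed B := by
  have h4 : ‖(4 : K)‖ ≠ 0 := by
    rw [norm_ne_zero_iff, show (4 : K) = 2 ^ 2 by norm_num]; exact pow_ne_zero _ h2
  set A : Set ↥(unitaryGroupOfForm σ J) := {u | ‖(((u : GL (Fin 2) K) : Matrix (Fin 2) (Fin 2) K) + 1).det‖ = ‖(4 : K)‖} with hA
  have hdetc : Continuous fun u' : ↥(unitaryGroupOfForm σ J) => (((u' : GL (Fin 2) K) : Matrix (Fin 2) (Fin 2) K) + 1).det :=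
    ((continuous_coe_mat σ J).add continuous_const).matrix_det
  have hAc : IsClosed A := isClosed_eq (continuous_norm.comp hdetc) continuous_const
  have hXA : ContinuousOn (fun u' : ↥(unitaryGroupOfForm σ J) =>
      (((u' : GL (Fin 2) K) : Matrix (Fin 2) (Fin 2) K) - 1) * (((u' : GL (Fin 2) K) : Matrix (Fin 2) (Fin 2) K) + 1)⁻¹) A := by
    intro u hu
    have hP' : (((u : GL (Fin 2) K) : Matrix (Fin 2) (Fin 2) K) + 1).det ≠ 0 := by
      rw [← norm_ne_zero_iff]; rw [hA, mem_setOf_eq] at hu; rw [hu]; exact h4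
    have ht : Tendsto (fun u' : ↥(unitaryGroupOfForm σ J) =>
        (((u' : GL (Fin 2) K) : Matrix (Fin 2) (Fin 2) K) - 1) * (((u' : GL (Fin 2) K) : Matrix (Fin 2) (Fin 2) K) + 1)⁻¹) (𝓝 u)
        (𝓝 ((((u : GL (Fin 2) K) : Matrix (Fin 2) (Fin 2) K) - 1) * (((u : GL (Fin 2) K) : Matrix (Fin 2) (Fin 2) K) + 1)⁻¹)) :=
      (continuousAt_inverseWindow hP').tendsto.comp ((continuous_coe_mat σ J).tendsto u)
    exact ht.mono_left nhdsWithin_le_nhds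
  -- the two invariant maps `‖tr X_u‖`, `‖det X_u‖` are continuous on `A`
  set f₁ : ↥(unitaryGroupOfForm σ J) → ℝ := fun u' =>
      ‖((((u' : GL (Fin 2) K) : Matrix (Fin 2) (Fin 2) K) - 1) * (((u' : GL (Fin 2) K) : Matrix (Fin 2) (Fin 2) K) + 1)⁻¹).trace‖ with hf₁
  set f₂ : ↥(unitaryGroupOfForm σ J) → ℝ := fun u' =>
      ‖((((u' : GL (Fin 2) K) : Matrix (Fin 2) (Fin 2) K) - 1) * (((u' : GL (Fin 2) K) : Matrix (Fin 2) (Fin 2) K) + 1)⁻¹).det‖ with hf₂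
  have hc₁ : ContinuousOn f₁ A := (continuous_norm.comp (continuous_id.matrix_trace)).comp_continuousOn hXA
  have hc₂ : ContinuousOn f₂ A := (continuous_norm.comp (continuous_id.matrix_det)).comp_continuousOn hXA
  -- `B = (A ∩ f₁⁻¹(−∞, ρ]) ∩ (A ∩ f₂⁻¹(−∞, ρ²])`, each piece closed
  have hBeq : B = (A ∩ f₁ ⁻¹' Iic ρ) ∩ (A ∩ f₂ ⁻¹' Iic (ρ ^ 2)) := by
    ext u
    simp only [mem_inter_iff, mem_preimage, mem_Iic, hA, mem_setOf_eq, hf₁, hf₂]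
    constructor
    · intro hu
      obtain ⟨_, ht, hd⟩ := (hB u).1 hu
      have hdet := norm_det_add_one_of_mem_ball σ J hB hρ h2 hu
      exact ⟨⟨hdet, ht⟩, ⟨hdet, hd⟩⟩
    · rintro ⟨⟨hdet, ht⟩, ⟨-, hd⟩⟩
      refine (hB u).2 ⟨isUnit_iff_ne_zero.2 ?_, ht, hd⟩
      rw [← norm_ne_zero_iff, hdet]; exact h4
  rw [hBeq]
  exact (hc₁.preimage_isClosed_of_isClosed hAc isClosed_Iic).inter (hc₂.preimage_isClosed_of_isClosed hAc isClosed_Iic)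

include hB in
/-- **(U1) THE EIGENVALUE BALL IS CLOPEN** (`0 < ρ < 1`, `2 ≠ 0`): open because `det(g + 1) ≠ 0` is an open condition on which `X_u`, `tr`, `det` are continuous and closed balls of an
ultrametric field are open; closed because `B` lies in the closed set `{‖det(g + 1)‖ = ‖4‖}` (`norm_det_add_one_of_mem_ball`) and is cut out of it by closed conditions.
[cite: PlatonovRapinchuk1994, §3.3] -/
theorem ball_isClopen (hρ0 : 0 < ρ) (hρ1 : ρ < 1) (h2 : (2 : K) ≠ 0) : IsClopen B :=
  ⟨isClosed_ball_aux σ J hB hρ1 h2, isOpen_ball_aux σ J hB hρ0⟩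

include hB in
/-- **(U1) `1 ∈ B` and `B` is a neighbourhood of `1`** (`0 < ρ < 1`, `2 ≠ 0`; `X_1 = 0`, `det(1 + 1) = 4 ∈ Kˣ`). [cite: PlatonovRapinchuk1994, §3.3] -/
theorem one_mem_ball_nhds (hρ0 : 0 < ρ) (hρ1 : ρ < 1) (h2 : (2 : K) ≠ 0) :
    (1 : ↥(unitaryGroupOfForm σ J)) ∈ B ∧ B ∈ 𝓝 (1 : ↥(unitaryGroupOfForm σ J)) :=
  ⟨one_mem_ball_aux σ J hB hρ0.le h2, (ball_isClopen σ J hB hρ0 hρ1 h2).2.mem_nhds (one_mem_ball_aux σ J hB hρ0.le h2)⟩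

include hB in
omit [IsUltrametricDist K] in
/-- `u ∈ B ⇒ x u x⁻¹ ∈ B` (`det(g + 1)`, `tr` and `det` of `X_{xux⁻¹} = x X_u x⁻¹` are conjugation invariant: ★ `det_conj_add_one`, ★ `inverseWindow_conj`, Mathlib
`Matrix.trace_units_conj`, `Matrix.det_units_conj`). [cite: PlatonovRapinchuk1994, §3.3] -/
private theorem conj_mem_ball_aux {u : ↥(unitaryGroupOfForm σ J)} (hu : u ∈ B) (x : ↥(unitaryGroupOfForm σ J)) : x * u * x⁻¹ ∈ B := by
  obtain ⟨hP, ht, hd⟩ := (hB u).1 hu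
  have hmat : (((x * u * x⁻¹ : ↥(unitaryGroupOfForm σ J)) : GL (Fin 2) K) : Matrix (Fin 2) (Fin 2) K) =
      ((x : GL (Fin 2) K) : Matrix (Fin 2) (Fin 2) K) * ((u : GL (Fin 2) K) : Matrix (Fin 2) (Fin 2) K) * (((x : GL (Fin 2) K)⁻¹ : GL (Fin 2) K) : Matrix (Fin 2) (Fin 2) K) := by
    simp only [Subgroup.coe_mul, Subgroup.coe_inv, Units.val_mul]
  rw [hB, hmat, det_conj_add_one, inverseWindow_conj (x : GL (Fin 2) K) hP, Matrix.trace_units_conj, Matrix.det_units_conj]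
  exact ⟨hP, ht, hd⟩

include hB in
omit [IsUltrametricDist K] in
/-- **(U2) `B` is Ad-STABLE**: `x u x⁻¹ ∈ B ⟺ u ∈ B` (`⇐`: the data `det(g + 1)`, `tr X_u`, `det X_u` are conjugation invariant; `⇒`: conjugate back by `x⁻¹`).
[cite: PlatonovRapinchuk1994, §3.3] -/
theorem conj_mem_ball_iff (u x : ↥(unitaryGroupOfForm σ J)) : x * u * x⁻¹ ∈ B ↔ u ∈ B := by
  refine ⟨fun h => ?_, fun h => conj_mem_ball_aux σ J hB h x⟩
  have h' := conj_mem_ball_aux σ J hB h x⁻¹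
  rwa [inv_inv, ← mul_assoc, ← mul_assoc, inv_mul_cancel, one_mul, mul_assoc, inv_mul_cancel, mul_one] at h'

include hB in
/-- **THE CAYLEY SCALING `Ψ_s` EXISTS ON `B`**: for `σ s = s` and `‖s‖·ρ < 1` there is `Ψ : U(σ, J)(K) → U(σ, J)(K)` whose value at `u ∈ B` is the unitary element with matrix
`c(s•X_u)` and inverse matrix `c(−s•X_u)` (the unit ★ `cayleyGL (s•X_u)`, unitary because `s•X_u` is skew: ★ `transpose_map_inverseWindow_add_eq_zero`, `skew_smul_of_fixed'`,
★ `transpose_map_cayley_mul_mul_cayley`); off `B` the value is `1` (never read). [cite: PlatonovRapinchuk1994, §3.3] [cite: HarishChandra1999AdmissibleDistributions, §3.1 Lemma 3.2] -/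
theorem exists_cayleyScaling (hσs : σ s = s) (hsρ : ‖s‖ * ρ < 1) :
    ∃ Ψ : ↥(unitaryGroupOfForm σ J) → ↥(unitaryGroupOfForm σ J), ∀ u ∈ B,
      (((Ψ u : ↥(unitaryGroupOfForm σ J)) : GL (Fin 2) K) : Matrix (Fin 2) (Fin 2) K) =
          cayley (s • ((((u : GL (Fin 2) K) : Matrix (Fin 2) (Fin 2) K) - 1) * (((u : GL (Fin 2) K) : Matrix (Fin 2) (Fin 2) K) + 1)⁻¹)) ∧
      ((((Ψ u : ↥(unitaryGroupOfForm σ J)) : GL (Fin 2) K)⁻¹ : GL (Fin 2) K) : Matrix (Fin 2) (Fin 2) K) =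
          cayley (-(s • ((((u : GL (Fin 2) K) : Matrix (Fin 2) (Fin 2) K) - 1) * (((u : GL (Fin 2) K) : Matrix (Fin 2) (Fin 2) K) + 1)⁻¹))) := by
  classical
  have hunit : ∀ u ∈ B, ∀ (hm : IsUnit (1 - s • ((((u : GL (Fin 2) K) : Matrix (Fin 2) (Fin 2) K) - 1) * (((u : GL (Fin 2) K) : Matrix (Fin 2) (Fin 2) K) + 1)⁻¹)).det)
      (hp : IsUnit (1 + s • ((((u : GL (Fin 2) K) : Matrix (Fin 2) (Fin 2) K) - 1) * (((u : GL (Fin 2) K) : Matrix (Fin 2) (Fin 2) K) + 1)⁻¹)).det),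
      cayleyGL (s • ((((u : GL (Fin 2) K) : Matrix (Fin 2) (Fin 2) K) - 1) * (((u : GL (Fin 2) K) : Matrix (Fin 2) (Fin 2) K) + 1)⁻¹)) hm hp ∈
        unitaryGroupOfForm σ J := by
    intro u hu hm hp
    obtain ⟨hP, -, -⟩ := isUnit_of_mem_ball σ J hB hsρ hu
    exact mem_unitaryGroupOfForm_iff.2 (transpose_map_cayley_mul_mul_cayley σ hm
      (skew_smul_of_fixed' σ (transpose_map_inverseWindow_add_eq_zero σ (mem_unitaryGroupOfForm_iff.1 u.2) hP) hσs))
  refine ⟨fun u => if h : u ∈ B then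
      ⟨cayleyGL (s • ((((u : GL (Fin 2) K) : Matrix (Fin 2) (Fin 2) K) - 1) * (((u : GL (Fin 2) K) : Matrix (Fin 2) (Fin 2) K) + 1)⁻¹))
          (isUnit_of_mem_ball σ J hB hsρ h).2.1 (isUnit_of_mem_ball σ J hB hsρ h).2.2,
        hunit u h _ _⟩ else 1, fun u hu => ?_⟩
  simp only [dif_pos hu]
  exact ⟨rfl, rfl⟩

end Model

end Summit.HodgeConjecture.HodgeConjecture.Cruxes.H413.K2E3CayleyScalingRankOne

end
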